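import Summits.NavierStokesRegularity.NavierStokesRegularity.Theorems.SoloSalvageChaabani2020Step7
import Literature.Analysis.FunctionSpaces.TorusEnstrophyTrilinear
import Mathlib.MeasureTheory.Integral.IntervalIntegral.FundThmCalculus
import HarnessLib

/-!
# Solo salvage for claim C22 `Chaabani2020`, part 3: Step 7 in full — a GLOBAL classical mean-zero
# solution on `𝕋³` lies in `L^∞(0,∞;H¹) ∩ L²(0,∞;H²)`

Continuation of `Theorems/SoloSalvageChaabani2020Step7.lean` (seat `ns-claims-salvage-p2`), which proved
clause (i) of `Literature.Claims.NS.Chaabani2020.Step_7` (`step7_bddAbove`: bounded enstrophy). Here clause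
(ii): `∫₀ᵀ ‖Δu‖₂² ≤ D` uniformly in `T`, from the tree's `H¹` balance
(`Torus.IsClassicalNSSolutionOn.hasDerivWithinAt_half_gradNormSq`:
`d/dt ½‖∇u‖² = −ν‖Δu‖² + ∫⟪(u·∇)u, Δu⟫`), the dissipation form of the trilinear estimate
(`Torus.abs_integral_inner_convect_laplacian_le_dissipation`: `|∫⟪(u·∇)u,Δu⟫| ≤ (ν/2)‖Δu‖² + (8K⁴/ν³)‖∇u‖⁶`,
FMRT 2001 (A.26b)/(A.44)–(A.46)), the uniform enstrophy bound `‖∇u‖² ≤ M` of part 2, and the energy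
equality `ν∫₀ᵀ‖∇u‖² ≤ ½‖u(0)‖²`: `(ν/2)∫₀ᵀ‖Δu‖² ≤ ½‖∇u(0)‖² + (8K⁴/ν³)M²·‖u(0)‖²/(2ν)`.

* `step7_l2h2` — clause (ii); `step7_holds : Step_7` — Step 7 HOLDS (classical: Leray 1934 eventual
  regularity / Foias–Temam; RRS 2016 §6). Solo lane.

WHAT THIS IS NOT: not a claim about NS regularity or blow-up; not a claim about any author beyond the
typed locator.
-/

noncomputable section

open Set MeasureTheory Filter intervalIntegral
open scoped RealInnerProductSpace

-- The mandated landing namespace repeats the summit name by design (D-0017).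
set_option linter.dupNamespace false

namespace Summit.NavierStokesRegularity.NavierStokesRegularity.Theorems

namespace Chaabani2020

open Literature.Claims.NS.Chaabani2020 Literature.Analysis Literature.Analysis.FluidPDE
  Literature.Analysis.FunctionSpaces

/-- **Step 7, second clause**: for a global classical mean-zero solution of the unforced equations on `𝕋³`
(`ν > 0`) there is `D` with `∫₀ᵀ ‖Δu‖₂² ≤ D` for every `T ≥ 0` (H¹ balance + trilinear estimate in
dissipation form + bounded enstrophy + energy equality). [cite: Chaabani2020, §2 l.282–284 p.8 with Thm 1.3 l.139–141 p.3]
[cite: RobinsonRodrigoSadowskiCUP2016, Thm 6.12 (p. 108)] -/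
theorem step7_l2h2 {ν : ℝ} (hν : 0 < ν)
    {u : ℝ → UnitAddTorus (Fin 3) → EuclideanSpace ℝ (Fin 3)} {p : ℝ → UnitAddTorus (Fin 3) → ℝ}
    (h : Torus.IsClassicalNSSolutionOn (Ici 0) ν 0 u p)
    (hmean : ∀ t : ℝ, 0 ≤ t → Torus.HasZeroMean (u t)) :
    ∃ D : ℝ, ∀ T : ℝ, 0 ≤ T →
      ∫ t in Icc 0 T, ∫ x, ‖Torus.laplacian (u t) x‖ ^ 2 ≤ D := by
  have hd : Fintype.card (Fin 3) = 3 := by simp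
  -- uniform enstrophy bound
  obtain ⟨M, hM⟩ := step7_bddAbove hν h hmean
  have hG : ∀ t : ℝ, 0 ≤ t → Torus.gradNormSq (u t) ≤ M := fun t ht => hM ⟨t, mem_Ici.2 ht, rfl⟩
  have hM0 : 0 ≤ M := (Torus.gradNormSq_nonneg (u 0)).trans (hG 0 le_rfl)
  -- trilinear constant
  obtain ⟨K, hK⟩ := Torus.abs_integral_inner_convect_laplacian_le_dissipation (d := Fin 3) hd
  set c : ℝ := 8 * (K : ℝ) ^ 4 / ν ^ 3 with hc
  have hc0 : 0 ≤ c := by rw [hc]; positivity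
  set E₀ : ℝ := Torus.kineticEnergy (u 0) with hE₀
  have hE₀0 : 0 ≤ E₀ := Torus.kineticEnergy_nonneg _
  set D : ℝ := 2 / ν * (2⁻¹ * Torus.gradNormSq (u 0) + c * M ^ 2 * (E₀ / ν)) with hD
  have hD0 : 0 ≤ D := by
    rw [hD]
    have := Torus.gradNormSq_nonneg (u 0)
    positivity
  refine ⟨D, fun T hT0 => ?_⟩
  rcases eq_or_lt_of_le hT0 with hT | hTpos
  · rw [← hT, Icc_self, Measure.restrict_singleton]
    simp [hD0]
  -- notation on `[0, T]`
  set S : Set ℝ := Icc 0 T with hS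
  have hU : UniqueDiffOn ℝ S := uniqueDiffOn_Icc hTpos
  have hSc : Convex ℝ S := convex_Icc 0 T
  have hT' : Torus.IsClassicalNSSolutionOn S ν 0 u p := h.mono Icc_subset_Ici_self hU
  have hu : Torus.IsSmoothSpaceTimeOn S u := hT'.smooth_velocity
  set L : ℝ → ℝ := fun t => ∫ x, ‖Torus.laplacian (u t) x‖ ^ 2 with hL
  set P : ℝ → ℝ := fun t => ∫ x, ⟪Torus.convect (u t) (u t) x -
      (0 : ℝ → UnitAddTorus (Fin 3) → EuclideanSpace ℝ (Fin 3)) t x, Torus.laplacian (u t) x⟫ with hP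
  set φ : ℝ → ℝ := fun t => 2⁻¹ * Torus.gradNormSq (u t) with hφ
  set φ' : ℝ → ℝ := fun t => -ν * L t + P t with hφ'
  -- the H¹ balance
  have hderiv : ∀ t ∈ S, HasDerivWithinAt φ (φ' t) S t := fun t ht =>
    hT'.hasDerivWithinAt_half_gradNormSq hTpos ht
  -- continuity of the data in time
  have hLs : Torus.IsSmoothSpaceTimeOn S (fun t x => ‖Torus.laplacian (u t) x‖ ^ 2) :=
    (hu.laplacian hU).normSq
  have hLc : ContinuousOn L S := hLs.continuousOn_integral hSc
  have h0s : Torus.IsSmoothSpaceTimeOn S (0 : ℝ → UnitAddTorus (Fin 3) → EuclideanSpace ℝ (Fin 3)) :=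
    contDiffOn_const
  have hPs : Torus.IsSmoothSpaceTimeOn S (fun t x => ⟪Torus.convect (u t) (u t) x -
      (0 : ℝ → UnitAddTorus (Fin 3) → EuclideanSpace ℝ (Fin 3)) t x, Torus.laplacian (u t) x⟫) :=
    ((hu.convect hu hU).sub h0s).inner (hu.laplacian hU)
  have hPc : ContinuousOn P S := hPs.continuousOn_integral hSc
  have hφ'c : ContinuousOn φ' S := (hLc.const_smul (-ν)).add hPc |>.congr (fun t _ => by
    simp [hφ', smul_eq_mul])
  have hGc : ContinuousOn (fun t => Torus.gradNormSq (u t)) S := hu.continuousOn_gradNormSq hSc hU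
  -- pointwise bound on the derivative: `φ' ≤ −(ν/2) L + c M² G`
  have hφ'le : ∀ t ∈ S, φ' t ≤ -(ν / 2) * L t + c * M ^ 2 * Torus.gradNormSq (u t) := by
    intro t ht
    have hut : Torus.IsSmooth (u t) := hu.isSmooth_slice ht
    have hdt : Torus.IsDivFree (u t) := hT'.divFree t ht
    have htri := hK ν hν (u t) hut hdt
    have hP' : P t = ∫ x, ⟪Torus.convect (u t) (u t) x, Torus.laplacian (u t) x⟫ := by
      simp only [hP, Pi.zero_apply, sub_zero]
    have hGt : Torus.gradNormSq (u t) ≤ M := hG t ht.1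
    have hGt0 : 0 ≤ Torus.gradNormSq (u t) := Torus.gradNormSq_nonneg _
    have hcube : Torus.gradNormSq (u t) ^ 3 ≤ M ^ 2 * Torus.gradNormSq (u t) := by
      have : Torus.gradNormSq (u t) ^ 2 ≤ M ^ 2 := pow_le_pow_left₀ hGt0 hGt 2
      nlinarith
    have hPle : P t ≤ ν / 2 * L t + c * Torus.gradNormSq (u t) ^ 3 := by
      rw [hP']
      exact (le_abs_self _).trans htri
    have : φ' t = -ν * L t + P t := rfl
    rw [this]
    nlinarith [mul_le_mul_of_nonneg_left hcube hc0]
  -- integrate the balance over `[0, T]`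
  have hcontφ : ContinuousOn φ S := fun t ht => (hderiv t ht).continuousWithinAt
  have hderiv' : ∀ t ∈ Ioo 0 T, HasDerivWithinAt φ (φ' t) (Ioi t) t := fun t ht =>
    ((hderiv t (Ioo_subset_Icc_self ht)).hasDerivAt (Icc_mem_nhds ht.1 ht.2)).hasDerivWithinAt
  have hφ'i : IntervalIntegrable φ' volume 0 T :=
    (hφ'c.mono (by rw [uIcc_of_le hTpos.le])).intervalIntegrable
  have hFTC : ∫ t in (0 : ℝ)..T, φ' t = φ T - φ 0 :=
    integral_eq_sub_of_hasDeriv_right_of_le hTpos.le hcontφ hderiv' hφ'i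
  have hLi : IntervalIntegrable L volume 0 T := (hLc.mono (by rw [uIcc_of_le hTpos.le])).intervalIntegrable
  have hGi : IntervalIntegrable (fun t => Torus.gradNormSq (u t)) volume 0 T :=
    (hGc.mono (by rw [uIcc_of_le hTpos.le])).intervalIntegrable
  have hint_le : ∫ t in (0 : ℝ)..T, φ' t ≤
      ∫ t in (0 : ℝ)..T, (-(ν / 2) * L t + c * M ^ 2 * Torus.gradNormSq (u t)) :=
    integral_mono_on hTpos.le hφ'i ((hLi.const_mul _).add (hGi.const_mul _)) (fun t ht => hφ'le t ht)
  rw [intervalIntegral.integral_add (hLi.const_mul _) (hGi.const_mul _), intervalIntegral.integral_const_mul,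
    intervalIntegral.integral_const_mul, hFTC] at hint_le
  -- the energy budget `ν ∫₀ᵀ G ≤ E₀`
  have hE := h.energy_eq (convex_Ici 0) hTpos.le (fun s hs => mem_Ici.2 hs.1)
  simp only [Pi.zero_apply, inner_zero_left, integral_zero, intervalIntegral.integral_zero,
    add_zero] at hE
  have hKT : 0 ≤ Torus.kineticEnergy (u T) := Torus.kineticEnergy_nonneg _
  have hGint : ∫ t in (0 : ℝ)..T, Torus.gradNormSq (u t) ≤ E₀ / ν := by
    rw [le_div_iff₀ hν]
    linarith
  have hφT : 0 ≤ φ T := by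
    simp only [hφ]
    exact mul_nonneg (by norm_num) (Torus.gradNormSq_nonneg _)
  have hφ0 : φ 0 = 2⁻¹ * Torus.gradNormSq (u 0) := rfl
  -- assemble
  have hmain : ν / 2 * ∫ t in (0 : ℝ)..T, L t ≤ 2⁻¹ * Torus.gradNormSq (u 0) + c * M ^ 2 * (E₀ / ν) := by
    have h1 := mul_le_mul_of_nonneg_left hGint (by positivity : 0 ≤ c * M ^ 2)
    linarith
  have hIcc : ∫ t in Icc 0 T, L t = ∫ t in (0 : ℝ)..T, L t := by
    rw [intervalIntegral.integral_of_le hTpos.le, integral_Icc_eq_integral_Ioc]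
  rw [hIcc, hD]
  rw [show 2 / ν * (2⁻¹ * Torus.gradNormSq (u 0) + c * M ^ 2 * (E₀ / ν)) =
    (ν / 2)⁻¹ * (2⁻¹ * Torus.gradNormSq (u 0) + c * M ^ 2 * (E₀ / ν)) by
      field_simp]
  rw [le_inv_mul_iff₀ (by positivity)]
  exact hmain

/-- **Step 7 HOLDS** (implicit l.284 p.8 with Thm 1.3 l.139–141 p.3): a global classical solution of the
unforced Navier–Stokes equations on `𝕋³` with mean-zero slices is bounded in `H¹` on `[0,∞)` and square
integrable in `H²` over `[0,∞)` — classical eventual-regularity bookkeeping (Leray 1934; Foias–Temam;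
RRS 2016 §6), assembled from tree theorems in this file and part 2. [cite: Chaabani2020, §2 l.282–284 p.8 with Thm 1.3 l.139–141 p.3] -/
theorem step7_holds : Literature.Claims.NS.Chaabani2020.Step_7 :=
  fun _ν hν _u _p h hmean => ⟨step7_bddAbove hν h hmean, step7_l2h2 hν h hmean⟩

end Chaabani2020

end Summit.NavierStokesRegularity.NavierStokesRegularity.Theorems
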